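import Summits.Langlands.Langlands.Theses.AbelianSurfaceSerre
import Literature.NumberTheory.PAdicHodge.FontaineDpst
import Literature.NumberTheory.GaloisRepresentations.LabelledHodgeTateWeights
import HarnessLib

/-!
# Route `AbelianSurfaceSerre`, crux `SerreGSp4Surjective` (stmt-Langlands-17765): vocabulary of the
# line `singer-type-evaporation`, and its stub `stub_compatibleTransfer`

Route-posited objects (D-0016 `<Route>Defs`-type file) shared by the registered stubs of the checked
skeleton `Cruxes/SerreGSp4Surjective/Lines/singer_type_evaporation.lean` (skeleton v2, registered
2026-08-17 by `ledger skeleton check`, lead prover-line-stmt-Langlands-17765-a1-0) and by the crux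
file that composes them.  NOTHING IS ASSERTED by the definitions: every `def … : Prop` below is a
*statement* consumed only as (part of) the type of a stub theorem or of the crux.  Declared in the
skeleton's namespace `Summit.Langlands.Langlands.Cruxes.SerreGSp4Surjective.SingerTypeEvaporation`,
so that a landed stub `theorem stub_<name> : <registered signature>` reads byte-identically to its
registration.

Objects:
* `FullSymplecticImage p ρ̄`, `OrdinaryDistinguishedAt p ρ̄`, `RegularOrdinaryModular p ρ̄` — the
  crux's hypotheses (H1), (H2) and its conclusion, VERBATIM (`serreGSp4Surjective_iff` is `Iff.rfl`);
* `cycInv ℓ` — `ε_ℓ⁻¹` pushed into `ℚ̄_ℓ` (the multiplier of every member of the line's family);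
* `ReducesTo ℓ r ρ'` — the crux's reduction device (integral characteristic polynomials of the
  `ℓ`-adic `r` reduce to those of `ρ' ⊗ k̄` along some `red : 𝒪_{ℚ̄_ℓ} → k̄`), for coefficients in any
  topological field `k` (the crux's last clause is the case `k = ZMod p`);
* `CoxeterPairAt e d w ρ` — an element `τ ∈ Γ_{ℚ_w}` acting with characteristic polynomial
  `∏_{i<4} (X - ζ^{e^i})`, `ζ` a primitive `d`-th root of unity, and `φ` with `ρ(φτφ⁻¹) = ρ(τ)^e`
  (Khare–Larsen–Savin's tame supercuspidal scar, resp. the Singer type at `p`, seen residually);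
* `TwistCertificate ℓ ρ'` — some `σ` with `tr ρ'(σ) ≠ 0` and `ε̄_ℓ(σ)` a non-square;
* `IrredOnCycKernel ℓ ρ'` — `ρ' ⊗ k̄` restricted to `ker ε̄_ℓ = Γ_{ℚ(ζ_ℓ)}` is irreducible (Mathlib
  `Representation.IsIrreducible`);
* `CompanionAE p ℓ r r'` — `r` is a companion of `r'`: for every `ι' : ℚ̄_ℓ ≃ ℂ` some `ι : ℚ̄_p ≃ ℂ`
  makes every Satake-type Frobenius polynomial of `r'` (via `ι'`) one of `r` (via `ι`) at almost all
  places, both unramified there;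
* `AutomorphicAE ℓ r` — a regular algebraic cuspidal `π` on `GL₄(𝔸_ℚ)` and `ι` with `r` unramified and
  Satake–Frobenius compatible with `(π, ι)` a.e. in the Harris–Lan–Taylor–Thorne normalisation
  `m = 4` — VERBATIM the automorphy clause of the crux's conclusion `RegularOrdinaryModular` (it
  differs from the tree's `Literature.NumberTheory.Automorphic.IsAutomorphicAE ι hcpt ρ` exactly by that
  normalisation: there `π` is L-algebraic and `m = 1`, here `π` is regular algebraic = C-algebraic and
  `m = 4`, the two being exchanged by `π ↦ π ⊗ |det|^{3/2}`; the crux fixes the latter, so the line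
  must too);
* `ResiduallyAutomorphic ℓ ρ'` — residual automorphy of `ρ'` from a regular algebraic cuspidal `π`
  unramified at `ℓ` whose `ℓ`-adic `r₁` is symplectic-`ε⁻¹`, crystalline at `ℓ` with Hodge–Tate
  weights in an interval of length `≤ ℓ - 2` (Fontaine–Laffaille, hence potentially diagonalisable:
  BLGGT Lemma 1.4.3) and reduces to `ρ'` — the residual hypothesis of BLGGT Thm 4.2.1;
* `IsCrystallineWithWeightsAt ℓ wts r` — crystalline at `v ∣ ℓ` for Fontaine's pinned datum with
  labelled Hodge–Tate weights EXACTLY `wts` at every `ℚ_ℓ`-algebra label `τ : ℚ_v →ₐ[ℚ_ℓ] ℚ̄_ℓ` (the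
  idiom of the accepted `BLGGT2014_thm421_GL2_totallyReal`).

Proved here (so that this vocabulary lands through a registered stub): the line's stub 5/6
`stub_compatibleTransfer` (registered signature, verbatim) — automorphy passes from the `ℓ`-adic
member to its `p`-adic companion: the SAME `π`, read through the `ι` that `CompanionAE` supplies for
the automorphy datum's `ι'`.

Not here (deliberately): the `Type`-valued interface `SingerFamily` of stubs 1, 3, 6 (appended when
one of those stubs is worked in-tree) and the other five stub statements.

References: BarnetlambEtAl2014 §2.1, §5.1, Thm 4.2.1, Lemma 1.4.3 (normalisations, compatible
systems, the lifting theorem the anchor feeds); HarrisLanTaylorThorneRMS2016 Thm A (`m = n`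
normalisation of `arithFrobPolyOfSatake`); arXiv:math/0610860 §3 (Khare–Larsen–Savin scar);
arXiv:2502.20645 Lemma 10.4.1 / Rem. 10.4.2 (the crux).
-/

set_option linter.dupNamespace false -- `Summit.Langlands.Langlands` is the mandated namespace

namespace Summit.Langlands.Langlands.Cruxes.SerreGSp4Surjective.SingerTypeEvaporation

open Literature.NumberTheory.GaloisRepresentations Literature.NumberTheory.Automorphic
  Literature.NumberTheory.PAdicHodge
open scoped NumberField
open IsDedekindDomain Polynomial

noncomputable section

/-! ## The crux's clauses, verbatim (same bodies as `Disproof.H1 / H2 / Concl`) -/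

/-- (H1) of the crux, verbatim: `ρ̄` preserves a non-degenerate alternating `J` up to `ε̄_p⁻¹` and
its image is ALL of `GSp(J)(𝔽_p)`. [folklore] -/
def FullSymplecticImage (p : ℕ) [Fact p.Prime] (ρ : FramedGaloisRep ℚ (ZMod p) 4) : Prop :=
  ∃ J : Matrix (Fin 4) (Fin 4) (ZMod p), J.transpose = -J ∧ IsUnit J.det ∧
    (∀ g : Field.absoluteGaloisGroup ℚ, (ρ g).val.transpose * J * (ρ g).val =
      (((modPCyclotomicCharacterZMod ℚ p g)⁻¹ : (ZMod p)ˣ) : ZMod p) • J) ∧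
    ∀ M : GL (Fin 4) (ZMod p), (∃ c : ZMod p, IsUnit c ∧ M.val.transpose * J * M.val = c • J) →
      M ∈ ρ.toMonoidHom.range

/-- (H2) of the crux, verbatim: at `v ∣ p`, `ρ̄|Γ_{ℚ_v}` is triangularisable over `𝔽̄_p` with
pairwise distinct diagonal characters. [folklore] -/
def OrdinaryDistinguishedAt (p : ℕ) [Fact p.Prime] (ρ : FramedGaloisRep ℚ (ZMod p) 4) : Prop :=
  ∀ v : HeightOneSpectrum (𝓞 ℚ), ((p : ℕ) : 𝓞 ℚ) ∈ v.asIdeal →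
    ∃ g : GL (Fin 4) (AlgebraicClosure (ZMod p)),
      (∀ (τ : Field.absoluteGaloisGroup (v.adicCompletion ℚ)) (i j : Fin 4), j < i →
        (g.val * ((ρ.toLocal v τ).val.map (algebraMap (ZMod p) (AlgebraicClosure (ZMod p)))) *
          (g⁻¹).val) i j = 0) ∧
      ∀ i j : Fin 4, i ≠ j → ∃ τ : Field.absoluteGaloisGroup (v.adicCompletion ℚ),
        (g.val * ((ρ.toLocal v τ).val.map (algebraMap (ZMod p) (AlgebraicClosure (ZMod p)))) *
            (g⁻¹).val) i i ≠
          (g.val * ((ρ.toLocal v τ).val.map (algebraMap (ZMod p) (AlgebraicClosure (ZMod p)))) *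
            (g⁻¹).val) j j

/-- The conclusion of the crux, verbatim (regular algebraic cuspidal `π` on `GL₄/ℚ` unramified at
`p`, `r` crystalline-ordinary of strictly increasing shape, Satake–Frobenius compatible a.e.,
symplectic, reducing to `ρ̄ ⊗ 𝔽̄_p`). [folklore] -/
def RegularOrdinaryModular (p : ℕ) [Fact p.Prime] (ρ : FramedGaloisRep ℚ (ZMod p) 4) :
    Prop :=
  ∃ (hcpt : isCompact_glFiniteIntegralLevel 4 ℚ) (π : CuspidalAutomorphicRepData 4 ℚ hcpt)
    (ι : PadicAlgCl p ≃+* ℂ) (r : FramedGaloisRep ℚ (PadicAlgCl p) 4),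
    π.1.IsRegularAlgebraic ∧
    (∀ v : HeightOneSpectrum (𝓞 ℚ), ((p : ℕ) : 𝓞 ℚ) ∈ v.asIdeal →
      π.1.IsUnramifiedAt v ∧ ∃ a : Fin 4 → ℕ, StrictMono a ∧ r.IsCrystallineOrdinaryOfShapeAt v a) ∧
    (∀ᶠ v : HeightOneSpectrum (𝓞 ℚ) in Filter.cofinite, ∃ a : Multiset ℂ,
      π.1.HasSatakeParamAt v a ∧ r.IsUnramifiedAt v ∧
        r.HasFrobCharpolyAt v (arithFrobPolyOfSatake ι v.residueCard 4 a)) ∧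
    (∃ ν : Field.absoluteGaloisGroup ℚ → PadicAlgCl p, r.IsSymplecticWithMultiplierFun ν) ∧
    ∃ red : (Valued.v : Valuation (PadicAlgCl p) NNReal).valuationSubring →+*
        AlgebraicClosure (ZMod p),
      ∀ g : Field.absoluteGaloisGroup ℚ,
        ∃ P : Polynomial (Valued.v : Valuation (PadicAlgCl p) NNReal).valuationSubring,
          P.map (Valued.v : Valuation (PadicAlgCl p) NNReal).valuationSubring.subtype =
              FramedRep.charpoly r g ∧
            P.map red = (FramedRep.charpoly ρ g).map (algebraMap (ZMod p) (AlgebraicClosure (ZMod p)))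


/-- The crux is literally `∃ p₀, ∀ p ≥ p₀, ∀ ρ̄, (H1) → (H2) → conclusion`. [folklore] -/
theorem serreGSp4Surjective_iff :
    Summit.Langlands.Langlands.Theses.AbelianSurfaceSerre.SerreGSp4Surjective ↔
      ∃ p₀ : ℕ, ∀ (p : ℕ) [Fact p.Prime], p₀ ≤ p → ∀ ρ : FramedGaloisRep ℚ (ZMod p) 4,
        FullSymplecticImage p ρ → OrdinaryDistinguishedAt p ρ → RegularOrdinaryModular p ρ :=
  Iff.rfl

/-! ## Typed vocabulary of the line -/

section Vocabulary

/-- `ε_ℓ(g)⁻¹ ∈ ℚ̄_ℓ`: the inverse `ℓ`-adic cyclotomic character pushed into `ℚ̄_ℓ` along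
`ℤ_ℓ ⊆ ℚ_ℓ → ℚ̄_ℓ` (the multiplier of every member of the family — pinned EXACTLY, cf.
`Disproof` §3 `WithoutMultiplier`). [folklore] -/
def cycInv (ℓ : ℕ) [Fact ℓ.Prime] (g : Field.absoluteGaloisGroup ℚ) : PadicAlgCl ℓ :=
  algebraMap ℚ_[ℓ] (PadicAlgCl ℓ)
    ((((GaloisRep.cyclotomicCharacter ℚ ℓ g)⁻¹ : ℤ_[ℓ]ˣ) : ℤ_[ℓ]) : ℚ_[ℓ])

/-- The crux's REDUCTION DEVICE, for an `ℓ`-adic `r` and a residual `ρ'` with coefficients in a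
field `k` (compared inside `k̄`): along some `red : 𝒪_{ℚ̄_ℓ} → k̄` the integral characteristic
polynomials of `r` reduce to those of `ρ' ⊗ k̄` (so `ρ'^ss ≅ r̄^ss`; verbatim the crux's last clause
with `(ZMod p, 𝔽̄_p)` replaced by `(k, k̄)`). [folklore] -/
def ReducesTo (ℓ : ℕ) [Fact ℓ.Prime] {k : Type} [Field k] [TopologicalSpace k]
    (r : FramedGaloisRep ℚ (PadicAlgCl ℓ) 4) (ρ' : FramedGaloisRep ℚ k 4) : Prop :=
  ∃ red : (Valued.v : Valuation (PadicAlgCl ℓ) NNReal).valuationSubring →+* AlgebraicClosure k,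
    ∀ g : Field.absoluteGaloisGroup ℚ,
      ∃ P : Polynomial (Valued.v : Valuation (PadicAlgCl ℓ) NNReal).valuationSubring,
        P.map (Valued.v : Valuation (PadicAlgCl ℓ) NNReal).valuationSubring.subtype =
            FramedRep.charpoly r g ∧
          P.map red = (FramedRep.charpoly ρ' g).map (algebraMap k (AlgebraicClosure k))

/-- **Coxeter pair at `w`** for a framed `ρ : Γ_ℚ → GL₄(A)` over a field `A` (any characteristic):
some `τ, φ ∈ Γ_{ℚ_w}` with `charpoly ρ(τ) = ∏_{i<4} (X - ζ^{e^i})` for a PRIMITIVE `d`-th root of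
unity `ζ ∈ Ā` and `ρ(φ τ φ⁻¹) = ρ(τ)^e`.  With `e` of order `4` mod `d` (`SingerFamily.order_four`)
the four eigenvalues are distinct and `ρ(φ)` permutes the eigenlines in a `4`-cycle, so `⟨ρ(τ), ρ(φ)⟩`
already acts irreducibly.  Intended instances: the Singer/Coxeter tame inertial type at `w = p`
(`e = p`, `d ∣ (p²+1)/2`, card (1)–(3)) and the Khare–Larsen–Savin depth-zero supercuspidal scar at an
auxiliary `w = q` (`e = q`, `d = p`, `q² ≡ -1 (mod p)`, available iff `p ≡ 1 (mod 4)`).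
[cite: KhareLarsenSavin2008, §3] -/
def CoxeterPairAt {A : Type} [Field A] [TopologicalSpace A] (e d : ℕ)
    (w : HeightOneSpectrum (𝓞 ℚ)) (ρ : FramedGaloisRep ℚ A 4) : Prop :=
  ∃ (ζ : AlgebraicClosure A) (τ φ : Field.absoluteGaloisGroup (w.adicCompletion ℚ)),
    IsPrimitiveRoot ζ d ∧
      (FramedRep.charpoly (ρ.toLocal w) τ).map (algebraMap A (AlgebraicClosure A)) =
        ∏ i : Fin 4, (X - C (ζ ^ e ^ (i : ℕ))) ∧
      (ρ.toLocal w) (φ * τ * φ⁻¹) = ((ρ.toLocal w) τ) ^ e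

/-- **Twist certificate at `ℓ`**: some `σ ∈ Γ_ℚ` has `tr ρ(σ) ≠ 0` while `ε̄_ℓ(σ)` is a NON-square
in `𝔽_ℓˣ`.  It kills `ρ ≅ ρ ⊗ χ` for the characters `χ` of `Gal(ℚ(ζ_ℓ)/ℚ)` of order `2` and `4`
(`χ(σ) ≠ 1`), i.e. `ρ` is not induced from the quadratic or quartic subfield of `ℚ(ζ_ℓ)` — the
only way a Coxeter-rigid `ρ` could become reducible on `Γ_{ℚ(ζ_ℓ)}` (Clifford).  For the family's
residual companions it follows from the Fontaine–Laffaille inertial weights `{-1,0,1,2}` at `ℓ ≥ 11`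
(a twist by `ω^{(ℓ-1)/2}` or `ω^{(ℓ-1)/4}` moves them). [folklore] -/
def TwistCertificate (ℓ : ℕ) [Fact ℓ.Prime] {k : Type} [Field k] [TopologicalSpace k]
    (ρ' : FramedGaloisRep ℚ k 4) : Prop :=
  ∃ σ : Field.absoluteGaloisGroup ℚ,
    Matrix.trace (ρ' σ).val ≠ 0 ∧ ¬ IsSquare (modPCyclotomicCharacterZMod ℚ ℓ σ)

/-- **`ρ'` is absolutely irreducible on `Γ_{ℚ(ζ_ℓ)} = ker ε̄_ℓ`**: the base change of `ρ'` to `k̄`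
restricted to the kernel of the mod-`ℓ` cyclotomic character is irreducible (Mathlib
`Representation.IsIrreducible`).  For `ℓ ≥ 2(4+1)` this is ADEQUACY of `ρ'(Γ_{ℚ(ζ_ℓ)})`
(Guralnick–Herzig–Taylor–Thorne), the image hypothesis of BLGGT Thm 4.2.1.
[cite: BarnetlambEtAl2014, Thm 4.2.1] -/
def IrredOnCycKernel (ℓ : ℕ) [Fact ℓ.Prime] {k : Type} [Field k] [TopologicalSpace k]
    (ρ' : FramedGaloisRep ℚ k 4) : Prop :=
  Representation.IsIrreducible
    (((FramedRep.baseChangeRepresentation (algebraMap k (AlgebraicClosure k)) ρ').comp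
        (modPCyclotomicCharacterZMod ℚ ℓ).ker.subtype :
      Representation (AlgebraicClosure k) (modPCyclotomicCharacterZMod ℚ ℓ).ker
        (Fin 4 → AlgebraicClosure k)))

/-- **The `p`-adic `r` is a companion of the `ℓ`-adic `r'`** (skeleton v2, R2; members of one weakly
compatible system read through `ℂ`, BLGGT §5.1): for EVERY `ι' : ℚ̄_ℓ ≃ ℂ` there is `ι : ℚ̄_p ≃ ℂ` such
that at almost every finite place both are unramified and every Satake-type Frobenius polynomial of
`r'` via `ι'` (`arithFrobPolyOfSatake ι' q_v 4 a = C_{q_v}(a).map ι'⁻¹`) is a Frobenius polynomial of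
`r` via `ι`.  For a compatible system with coefficients in a number field `E` this holds with `ι`
any extension of `ι' ∘ j_ℓ ∘ j_p⁻¹` from `j_p(E)` to `ℚ̄_p` (Frobenius polynomials are unique,
`GaloisRep.HasFrobCharpolyAt.unique_holds`). [cite: BarnetlambEtAl2014, §5.1] -/
def CompanionAE (p ℓ : ℕ) [Fact p.Prime] [Fact ℓ.Prime] (r : FramedGaloisRep ℚ (PadicAlgCl p) 4)
    (r' : FramedGaloisRep ℚ (PadicAlgCl ℓ) 4) : Prop :=
  ∀ ι' : PadicAlgCl ℓ ≃+* ℂ, ∃ ι : PadicAlgCl p ≃+* ℂ,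
    ∀ᶠ v : HeightOneSpectrum (𝓞 ℚ) in Filter.cofinite,
      r.IsUnramifiedAt v ∧ r'.IsUnramifiedAt v ∧
        ∀ a : Multiset ℂ, r'.HasFrobCharpolyAt v (arithFrobPolyOfSatake ι' v.residueCard 4 a) →
          r.HasFrobCharpolyAt v (arithFrobPolyOfSatake ι v.residueCard 4 a)

/-- **`r : Γ_ℚ → GL₄(ℚ̄_ℓ)` is automorphic (a.e. form, the crux's normalisation `m = 4`)**: a regular
algebraic cuspidal `π` on `GL₄(𝔸_ℚ)` and `ι : ℚ̄_ℓ ≃ ℂ` with `r` unramified and Satake–Frobenius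
compatible with `(π, ι)` at almost every place. [cite: BarnetlambEtAl2014, §2.1] -/
def AutomorphicAE (ℓ : ℕ) [Fact ℓ.Prime] (r : FramedGaloisRep ℚ (PadicAlgCl ℓ) 4) : Prop :=
  ∃ (hcpt : isCompact_glFiniteIntegralLevel 4 ℚ) (π : CuspidalAutomorphicRepData 4 ℚ hcpt)
    (ι : PadicAlgCl ℓ ≃+* ℂ),
    π.1.IsRegularAlgebraic ∧
      ∀ᶠ v : HeightOneSpectrum (𝓞 ℚ) in Filter.cofinite, ∃ a : Multiset ℂ,
        π.1.HasSatakeParamAt v a ∧ r.IsUnramifiedAt v ∧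
          r.HasFrobCharpolyAt v (arithFrobPolyOfSatake ι v.residueCard 4 a)

/-- **Residual automorphy of `ρ' : Γ_ℚ → GL₄(k)` at `ℓ` from a POTENTIALLY DIAGONALISABLE source**
(the ANCHOR's conclusion = BLGGT Thm 4.2.1's residual hypothesis): some regular algebraic cuspidal
`π` on `GL₄/ℚ` UNRAMIFIED at `ℓ`, `ι`, and an `ℓ`-adic `r₁`, symplectic with multiplier `ε_ℓ⁻¹`
(so `π` is essentially self-dual: BLGGT's polarised source), Satake–Frobenius compatible with
`(π, ι)` a.e., CRYSTALLINE at `ℓ` with Hodge–Tate weights in an interval of length `≤ ℓ - 2`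
(Fontaine–Laffaille ⇒ potentially diagonalisable, BLGGT Lemma 1.4.3), reducing to `ρ'`.  ANY level
away from `ℓ`, ANY such weight (level-tolerant, weight-tolerant anchor).
[cite: BarnetlambEtAl2014, Thm 4.2.1 and Lemma 1.4.3] -/
def ResiduallyAutomorphic (ℓ : ℕ) [Fact ℓ.Prime] {k : Type} [Field k] [TopologicalSpace k]
    (ρ' : FramedGaloisRep ℚ k 4) : Prop :=
  ∃ (hcpt : isCompact_glFiniteIntegralLevel 4 ℚ) (π : CuspidalAutomorphicRepData 4 ℚ hcpt)
    (ι : PadicAlgCl ℓ ≃+* ℂ) (r₁ : FramedGaloisRep ℚ (PadicAlgCl ℓ) 4),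
    π.1.IsRegularAlgebraic ∧ r₁.IsSymplecticWithMultiplierFun (cycInv ℓ) ∧
    (∀ (v : HeightOneSpectrum (𝓞 ℚ)) (hv : ((ℓ : ℕ) : 𝓞 ℚ) ∈ v.asIdeal),
      π.1.IsUnramifiedAt v ∧ (fontainePstAdicCompletion v ℓ hv).IsCrystallineFramed (r₁.toLocal v) ∧
        ∃ a b : ℤ, b - a + 2 ≤ (ℓ : ℤ) ∧
          (fontainePstAdicCompletion v ℓ hv).IsDeRhamWithWeightsIn a b (r₁.toLocal v)) ∧
    (∀ᶠ v : HeightOneSpectrum (𝓞 ℚ) in Filter.cofinite, ∃ s : Multiset ℂ,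
      π.1.HasSatakeParamAt v s ∧ r₁.IsUnramifiedAt v ∧
        r₁.HasFrobCharpolyAt v (arithFrobPolyOfSatake ι v.residueCard 4 s)) ∧
    ReducesTo ℓ r₁ ρ'

/-- Crystalline at `v ∣ ℓ` with labelled Hodge–Tate weights EXACTLY the multiset `wts` (relative to
the summit's pinned Fontaine datum; an exact multiset, not a bound — wave-1 correction of line
`Sketch`, `Disproof` §4).  The family's common weight `wts` is REGULAR (`SingerFamily.wts_nodup`) and
lies in a recorded interval `[lo, hi]` (`wts_range`; the anchor prime is taken with `hi - lo + 2 ≤ ℓ`,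
Fontaine–Laffaille range — no hand-picked bound); the weights are symmetric about `1/2` since the
multiplier is `ε⁻¹`
(`{a, b, 1-b, 1-a}`, e.g. the Calabi–Yau-shifted `{-1,0,1,2}`), and this freedom in `wts` is what lets
the typed lift at `p` exist for NON-generic ordinary `ρ̄|Γ_{ℚ_p}` (Breuil–Mézard: vary the algebraic
weight tensoring the type; cf. très ramifiée `ρ̄` in `GL₂`, which have no potentially Barsotti–Tate
lift of supercuspidal type but do have typed lifts of weight `{0,2}`).
Skeleton v2 (R1): the label `τ` ranges over `ℚ_ℓ`-ALGEBRA embeddings `ℚ_v →ₐ[ℚ_ℓ] ℚ̄_ℓ` for the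
pinned datum's algebra structure (as in the accepted `BLGGT2014_thm421_GL2_totallyReal`), not over
all ring homomorphisms (for a non-structure `τ` the `τ`-component of `D` is `0` and `HT_τ = ∅`).
[cite: BarnetlambEtAl2014, Introduction (Notation)] -/
def IsCrystallineWithWeightsAt (ℓ : ℕ) [Fact ℓ.Prime] (wts : Multiset ℤ)
    (r : FramedGaloisRep ℚ (PadicAlgCl ℓ) 4) : Prop :=
  ∀ (v : HeightOneSpectrum (𝓞 ℚ)) (hv : ((ℓ : ℕ) : 𝓞 ℚ) ∈ v.asIdeal),
    (fontainePstAdicCompletion v ℓ hv).IsCrystallineFramed (r.toLocal v) ∧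
      letI := (fontainePstAdicCompletion v ℓ hv).algebra
      ∀ τ : v.adicCompletion ℚ →ₐ[ℚ_[ℓ]] PadicAlgCl ℓ,
        r.labelledHodgeTateWeightsAt v (fontainePstAdicCompletion v ℓ hv).algebra
          (fontainePstAdicCompletion v ℓ hv).𝔅 τ.toRingHom = wts

end Vocabulary

/-! ## Stub 5/6 of the line: automorphy passes to a companion -/

/-- **Stub `stub_compatibleTransfer` (registered signature, verbatim).**  If the `ℓ`-adic `r'` is
automorphic — `π` regular algebraic cuspidal on `GL₄(𝔸_ℚ)` and `ι'` with `r'` Satake–Frobenius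
compatible with `(π, ι')` a.e. — and the `p`-adic `r` is a companion of `r'` (`CompanionAE`: for this
`ι'` some `ι` turns every Satake-type Frobenius polynomial of `r'` via `ι'` into one of `r` via `ι`,
a.e.), then `r` is automorphic: the same `π`, read through `ι`. [folklore] -/
theorem stub_compatibleTransfer :
    ∀ (p ℓ : ℕ) [Fact p.Prime] [Fact ℓ.Prime] (r : FramedGaloisRep ℚ (PadicAlgCl p) 4)
      (r' : FramedGaloisRep ℚ (PadicAlgCl ℓ) 4),
      CompanionAE p ℓ r r' → AutomorphicAE ℓ r' → AutomorphicAE p r := by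
  intro p ℓ _ _ r r' hc h
  obtain ⟨hcpt, π, ι', hreg, hev⟩ := h
  obtain ⟨ι, hι⟩ := hc ι'
  refine ⟨hcpt, π, ι, hreg, ?_⟩
  filter_upwards [hev, hι] with v hv hw
  obtain ⟨a, hsat, -, hfrob⟩ := hv
  exact ⟨a, hsat, hw.1, hw.2.2 a hfrob⟩

end

end Summit.Langlands.Langlands.Cruxes.SerreGSp4Surjective.SingerTypeEvaporation
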